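import Summits.PneNP.PneNP.Theorems.CodingVolumeShiftsCodingVolumeRungs

/-!
# Route CodingVolumeShifts — crux `CodingVolume` (stmt-PneNP-19454): effective arcs of a general
# one-shot code

Semantic (code-level, no linearity) counterparts of the structural lemmas used by the linear `C = 4`
rung, as groundwork for the general-code cell (blueprint attached to the item). An arc is EFFECTIVE
when its bit is not constant.

* `codingVolume_source_arc_literal` — an effective arc out of `source i` carries `x_i` or `¬x_i`;
* `codingVolume_single_inArc_literal`, `codingVolume_single_inArc_tail` — if `sink i` has a single
  in-arc, that arc carries `x_i` or `¬x_i`, its tail is a middle vertex (for a `2`-far pair), and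
  the bits entering the tail determine `x_i`;
* `codingVolume_val_eq_of_agree_effective` — SUPPORT: an arc leaving a middle vertex of rank `≤ r`
  carries the same bit on two inputs that agree on every commodity having an effective arc into a
  middle vertex of rank `≤ r`;
* `codingVolume_exists_effective_middle_arc` — every source of a `2`-far coded network has an
  effective arc into a middle vertex.

No definitions ("effective", "middle" are spelled out). [folklore]
-/

set_option linter.dupNamespace false -- `Summit.PneNP.PneNP.…`: summit = sub-problem name (D-0017)

namespace Summit.PneNP.PneNP.Theorems

open Literature.InformationTheory.NetworkCoding Finset

section Effective

variable {ι : Type} {N : KPairsNet ι}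

/-- An arc out of `source i` carries a function of `x_i` alone. [folklore] -/
theorem codingVolume_source_arc_depends (c : N.Code) (a : N.A) {i : ι} (ha : N.src a = N.source i)
    (x x' : ι → Bool) (hx : x i = x' i) : c.val a x = c.val a x' := by
  refine c.local_ a x x' (fun b hb => absurd (hb.trans ha) (N.source_in b i)) (fun j hj => ?_)
  have : j = i := N.source.injective (hj.trans ha)
  subst this
  exact hx

/-- **An effective source arc is a literal.** If an arc out of `source i` is not constant, it
carries `x_i` XOR a fixed bit. [folklore] -/
theorem codingVolume_source_arc_literal (c : N.Code) (a : N.A) {i : ι} (ha : N.src a = N.source i)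
    (heff : ∃ y y' : ι → Bool, c.val a y ≠ c.val a y') :
    ∃ neg : Bool, ∀ x : ι → Bool, c.val a x = xor neg (x i) := by
  classical
  obtain ⟨y, y', hyy⟩ := heff
  -- the bit is `g (x i)` for `g t := c.val a (y with x_i := t)`
  have hg : ∀ x : ι → Bool, c.val a x = c.val a (Function.update y i (x i)) := fun x =>
    codingVolume_source_arc_depends c a ha x _ (by simp)
  -- values of `g` at `false` and `true` differ
  have hne : c.val a (Function.update y i false) ≠ c.val a (Function.update y i true) := by
    intro h
    apply hyy
    rw [hg y, hg y']
    rcases Bool.eq_false_or_eq_true (y i) with h1 | h1 <;>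
      rcases Bool.eq_false_or_eq_true (y' i) with h2 | h2 <;> rw [h1, h2]
    · exact h.symm
    · exact h
  refine ⟨c.val a (Function.update y i false), fun x => ?_⟩
  rw [hg x]
  rcases Bool.eq_false_or_eq_true (x i) with hxi | hxi <;> rw [hxi]
  · -- `x i = true`: the value is the other one
    rw [Bool.xor_true]
    revert hne
    rcases Bool.eq_false_or_eq_true (c.val a (Function.update y i false)) with h1 | h1 <;>
      rcases Bool.eq_false_or_eq_true (c.val a (Function.update y i true)) with h2 | h2 <;>
      rw [h1, h2] <;> decide
  · rw [Bool.xor_false]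

/-- **A single in-arc of a sink is a literal.** If the arcs into `sink i` are exactly `{b}`, then
`b` carries `x_i` XOR a fixed bit (decodability from one bit). [folklore] -/
theorem codingVolume_single_inArc_literal [DecidableEq ι] (c : N.Code) (i : ι) (b : N.A)
    (hb : N.inArcs (N.sink i) = {b}) :
    ∃ neg : Bool, ∀ x : ι → Bool, c.val b x = xor neg (x i) := by
  classical
  -- decodability from the single bit: equal bits force equal `x_i`
  have hdec : ∀ x x' : ι → Bool, c.val b x = c.val b x' → x i = x' i := by
    intro x x' h
    refine c.decode i x x' (fun b' hb' => ?_)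
    have : b' ∈ N.inArcs (N.sink i) := by simp [KPairsNet.inArcs, hb']
    rw [hb, Finset.mem_singleton] at this
    rw [this, h]
  refine ⟨c.val b (fun _ => false), fun x => ?_⟩
  -- the input `e_i`
  let y : ι → Bool := Function.update (fun _ => false) i true
  have hy : y i = true := by simp [y]
  have hy0 : c.val b y ≠ c.val b (fun _ => false) := fun h => by
    have := hdec y (fun _ => false) h
    rw [hy] at this
    exact Bool.noConfusion this
  rcases Bool.eq_false_or_eq_true (x i) with hxi | hxi <;> rw [hxi]
  · -- `x i = true`: the bit differs from the bit at `0`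
    rw [Bool.xor_true]
    have hx0 : c.val b x ≠ c.val b (fun _ => false) := fun h => by
      have := hdec x (fun _ => false) h
      rw [hxi] at this
      exact Bool.noConfusion this
    revert hx0
    rcases Bool.eq_false_or_eq_true (c.val b x) with h1 | h1 <;>
      rcases Bool.eq_false_or_eq_true (c.val b (fun _ => false)) with h2 | h2 <;>
      rw [h1, h2] <;> decide
  · -- `x i = false`: the bit equals the bit at `0` (else it equals the bit at `e_i`)
    rw [Bool.xor_false]
    by_contra hx0
    have hxy : c.val b x = c.val b y := by
      revert hx0 hy0
      rcases Bool.eq_false_or_eq_true (c.val b x) with h1 | h1 <;>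
        rcases Bool.eq_false_or_eq_true (c.val b (fun _ => false)) with h2 | h2 <;>
        rcases Bool.eq_false_or_eq_true (c.val b y) with h3 | h3 <;>
        rw [h1, h2, h3] <;> decide
    have := hdec x y hxy
    rw [hxi, hy] at this
    exact Bool.noConfusion this

/-- The tail of the single in-arc of `sink i` is a middle vertex (for a `2`-far pair), and the bits
entering it determine `x_i`. [folklore] -/
theorem codingVolume_single_inArc_tail [DecidableEq ι] (c : N.Code) (i : ι) (b : N.A)
    (hb : N.inArcs (N.sink i) = {b}) (hfar : (2 : ℕ∞) ≤ N.graph.edist (N.source i) (N.sink i)) :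
    (∀ l, N.src b ≠ N.source l) ∧ (∀ l, N.src b ≠ N.sink l) ∧
      ∀ x x' : ι → Bool, (∀ b', N.tgt b' = N.src b → c.val b' x = c.val b' x') → x i = x' i := by
  classical
  obtain ⟨neg, hlit⟩ := codingVolume_single_inArc_literal c i b hb
  have hbt : N.tgt b = N.sink i := by
    have : b ∈ N.inArcs (N.sink i) := by rw [hb]; exact Finset.mem_singleton_self b
    simpa [KPairsNet.inArcs] using this
  have hns : ∀ l, N.src b ≠ N.source l := by
    intro l hl
    by_cases hli : l = i
    · subst hli
      have hne : N.source l ≠ N.sink l := by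
        intro h; rw [h, SimpleGraph.edist_self] at hfar; exact absurd hfar (by decide)
      have hadj : N.graph.Adj (N.source l) (N.sink l) := by
        rw [KPairsNet.graph, SimpleGraph.fromRel_adj]
        exact ⟨hne, Or.inl ⟨b, hl, hbt⟩⟩
      rw [SimpleGraph.edist_eq_one_iff_adj.mpr hadj] at hfar
      exact absurd hfar (by decide)
    · -- the bit would be a function of `x_l`, but it is `x_i ⊕ neg`
      have h := codingVolume_source_arc_depends c b hl (fun _ => false)
        (Function.update (fun _ => false) i true) (by simp [hli])
      rw [hlit, hlit] at h
      simp at h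
  refine ⟨hns, fun l => N.sink_out b l, fun x x' hin => ?_⟩
  have h := c.local_ b x x' hin (fun l hl => absurd hl.symm (hns l))
  rw [hlit, hlit] at h
  simpa using h

/-- **SUPPORT (semantic form).** Fix `r`. If two inputs agree on every commodity whose source has an
EFFECTIVE (non-constant) arc into a middle vertex of rank `≤ r`, then every arc leaving a middle
vertex of rank `≤ r` carries the same bit on both: by rank induction, the in-arcs of such a tail
come from lower middle vertices or from sources, and a source arc into a middle vertex of rank `≤ r`
is either effective (so its commodity is among the agreed ones) or constant. [folklore] -/
theorem codingVolume_val_eq_of_agree_effective (c : N.Code) (r : ℕ) {x x' : ι → Bool}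
    (hx : ∀ j, (∃ a, N.src a = N.source j ∧ (∀ l, N.tgt a ≠ N.sink l) ∧ N.rank (N.tgt a) ≤ r ∧
      ∃ y y' : ι → Bool, c.val a y ≠ c.val a y') → x j = x' j)
    (a : N.A) (haM : ∀ j, N.src a ≠ N.source j) (har : N.rank (N.src a) ≤ r) :
    c.val a x = c.val a x' := by
  suffices h : ∀ (q : ℕ) (a : N.A), N.rank (N.src a) = q → (∀ j, N.src a ≠ N.source j) →
      N.rank (N.src a) ≤ r → c.val a x = c.val a x' from h _ a rfl haM har
  intro q
  induction q using Nat.strong_induction_on with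
  | _ q ih =>
    intro a hq haM har
    refine c.local_ a x x' (fun b hb => ?_) (fun j hj => absurd hj.symm (haM j))
    by_cases hsb : ∃ j, N.src b = N.source j
    · obtain ⟨j, hj⟩ := hsb
      by_cases heff : ∃ y y' : ι → Bool, c.val b y ≠ c.val b y'
      · -- effective source arc into a middle vertex of rank `≤ r`: agreed commodity
        have hxj : x j = x' j :=
          hx j ⟨b, hj, fun l hl => N.sink_out a l (hb.symm.trans hl), by rw [hb]; exact har, heff⟩
        exact codingVolume_source_arc_depends c b hj x x' hxj
      · push Not at heff
        exact heff x x'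
    · push Not at hsb
      have hlt : N.rank (N.src b) < q := by rw [← hq, ← hb]; exact N.rank_lt b
      exact ih _ hlt b rfl hsb (by have := N.rank_lt b; rw [hb] at this; omega)

/-- **Every source has an effective arc into a middle vertex** (general codes, `2`-far pair):
otherwise no arc leaving a middle vertex depends on `x_i` (support with the agreed set "all but
`i`"), the arcs into `sink i` come from middle vertices or from other sources, and decoding fails
between `x` and `x` with `x_i` flipped. [folklore] -/
theorem codingVolume_exists_effective_middle_arc [DecidableEq ι] (c : N.Code) (i : ι)
    (hfar : (2 : ℕ∞) ≤ N.graph.edist (N.source i) (N.sink i)) :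
    ∃ a, N.src a = N.source i ∧ (∀ l, N.tgt a ≠ N.sink l) ∧
      ∃ y y' : ι → Bool, c.val a y ≠ c.val a y' := by
  classical
  by_contra hno
  push Not at hno
  -- the inputs `0` and `e_i` agree on every commodity with an effective middle arc of any rank
  let x : ι → Bool := fun _ => false
  let x' : ι → Bool := Function.update (fun _ => false) i true
  set R := Finset.univ.sup N.rank with hR
  have hagree : ∀ j, (∃ a, N.src a = N.source j ∧ (∀ l, N.tgt a ≠ N.sink l) ∧
      N.rank (N.tgt a) ≤ R ∧ ∃ y y' : ι → Bool, c.val a y ≠ c.val a y') → x j = x' j := by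
    rintro j ⟨a, ha, hM, -, y, y', hyy⟩
    by_cases hji : j = i
    · subst hji; exact absurd (hno a ha hM y y') hyy
    · simp [x, x', hji]
  have key := c.decode i x x' (fun b hb => ?_)
  · simp [x, x'] at key
  by_cases hsb : ∃ j, N.src b = N.source j
  · obtain ⟨j, hj⟩ := hsb
    by_cases hji : j = i
    · subst hji
      exfalso
      have hne : N.source j ≠ N.sink j := by
        intro h; rw [h, SimpleGraph.edist_self] at hfar; exact absurd hfar (by decide)
      have hadj : N.graph.Adj (N.source j) (N.sink j) := by
        rw [KPairsNet.graph, SimpleGraph.fromRel_adj]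
        exact ⟨hne, Or.inl ⟨b, hj, hb⟩⟩
      rw [SimpleGraph.edist_eq_one_iff_adj.mpr hadj] at hfar
      exact absurd hfar (by decide)
    · exact codingVolume_source_arc_depends c b hj x x' (by simp [x, x', hji])
  · push Not at hsb
    exact codingVolume_val_eq_of_agree_effective c R hagree b hsb
      (Finset.le_sup (f := N.rank) (Finset.mem_univ _))

end Effective

end Summit.PneNP.PneNP.Theorems
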